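import Summits.HubbardSuperconductivity.HubbardSuperconductivity.Theorems.WindowGap.Negative.PairFreeConfigurations
import Summits.HubbardSuperconductivity.HubbardSuperconductivity.Theorems.ThermalWedgeTwTipContinuationEdgeOrderFreeBound
import Summits.HubbardSuperconductivity.HubbardSuperconductivity.Theorems.BalabanIRBirEveryGroundStateSchur
import Summits.HubbardSuperconductivity.HubbardSuperconductivity.Theorems.DeformationLadderLowEnergyRigidityTelescopeNormalForms
import Summits.HubbardSuperconductivity.HubbardSuperconductivity.Theorems.NoGoNogoThesis
import Literature.MathematicalPhysics.QuantumLattice.HubbardPairDensityCouplingFloor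

/-!
# Crux `WindowGap` (stmt-HubbardSuperconductivity-1088), negative side: PENALTY SATURATION
# (target (T2) of `Cruxes/WindowGap/NOTES.md` §6; line lead c3, 2026-08-16)

For the Kac-window pair penalty `W_ε = L⁻² Σ_{|q_m| ≤ ε} Δ_g(m)ᴴ Δ_g(m)` of route `KacWindowPenalty`
(`Δ_g(m) = pairFieldAt g L m`, any form factor `g`, any window radius `ε`) the penalised sector energy
`g_L(λ) = minEnergyOn (H_L + λ W_ε) K_L`, `H_L = hubbardTorus 2 L t U`, `K_L = szSector (2n) 0`,
SATURATES in the coupling: the sector `K_L` contains states supported on ONE pair-free occupation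
configuration `A↑ ∪ B↓` (`PairFreeConfigurations.lean`: every `↑` electron in the rows `0 … h-1`, every
`↓` electron in the rows `h+1 … L-2`, `h = L/2 - 1`, as soon as `n ≤ hL`), on which `W_ε` vanishes and
the Hubbard energy is `0`. Hence:

* `penalised_minEnergyOn_le_zero` — `minEnergyOn (H_L + λ W_ε) (szSector (2n) 0) ≤ 0` for ALL real
  `t, U, λ, ε`, every `g` and `n ≤ (L/2-1)L`;
* `neg_eight_mul_le_minEnergyOn_hubbardTorus` — `-8n ≤ minEnergyOn H_L (szSector (2n) 0)` for `U ≥ 0`,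
  `L ≥ 3`, `n ≤ L²` (kinetic energy `≥ -4` per electron: `re_expect_hubbardTorus_zero_ge` at `μ = -4`);
* `windowGap_saturation` — `minEnergyOn (H_L + λW_ε) K − minEnergyOn H_L K ≤ 8n` for `U ≥ 0`, `L ≥ 3`,
  `n ≤ (L/2-1)L`, ALL real `λ`, `ε`; at the summit's filling `n = ⌊(1-δ)L²/2⌋` (`0 < δ ≤ 1`, even
  `L ≥ 2/δ`: `floor_pairNumber_le_rows`) this is `≤ 4(1-δ)L²` (`windowGap_saturation_doping`): the window
  excess is at most `4` per electron however strong the penalty;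
* `localRepulsion_minEnergyOn_le_zero`, `localBase_saturation` — the same for the LOCAL repulsion
  `Σ_x P_xᴴP_x` (full-window form of `W_ε`; base clause of line parabolic-descent): `≤ 0` and `≤ 8n`;
* `windowGap_coupling_mul_consts_le` — consequence for witnesses of the crux body: if
  `λ(Cε + a)L² ≤ g_L(λ) − g_L(0)` for all large even `L` (`U ≥ 0`, `δ ∈ (0,1)`), then
  `λ(Cε + a) ≤ 4(1-δ)`. With the landed λ-free ceiling `Cε + a ≤ 32` (`windowGapAt_consts_le`, p98536)
  and concavity (`windowGap_small_lam`, p99835: WLOG `λ` small) this closes the bookkeeping of the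
  coupling: a large `λ` is not merely unnecessary but useless (`λ·a < 4`), i.e.
  `sup_λ (g_L(λ) − g_L(0))/L² ≤ 4(1-δ)` — the escape channel "separate the spin species" is always open
  at bounded cost per electron, whatever `(U, ε, λ)`.

No definitions, no named facts; `--supports stmt-HubbardSuperconductivity-1088`.
Sources: H. Tasaki, Physics and Mathematics of Quantum Many-Body Systems (2020) §2.1 (variational
principle); E. H. Lieb, PRL 62 (1989) 1201. Folklore finite-dimensional statements.
Tree search: `minEnergyOn_le_re_rayleigh`, `LowEnergyRigidity.Telescope.le_minEnergyOn_of_forall_unit`,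
`IsogapTransport.re_expect_hubbardTorus_zero_ge`, `neg_four_le_torusBand`,
`hubbardTorus_eq_zero_add_smul_interaction`, `re_expect_interaction_torus_mem_Icc`,
`NoGo.exists_unit_groundStateInSector_hubbardTorus`, `exists_pairFree_sets`,
`kacWindow_mulVec_eq_zero_of_supported`, `star_dotProduct_hubbardTorus_mulVec_eq_zero_of_supported`.
-/

-- the mandated namespace repeats `HubbardSuperconductivity` (single-problem summit, D-0017)
set_option linter.dupNamespace false

noncomputable section

namespace Summit.HubbardSuperconductivity.HubbardSuperconductivity.Theorems.WindowGap.Negative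

open Matrix Finset Literature.MathematicalPhysics.QuantumLattice Literature.Probability.LatticeModels
open scoped ComplexOrder ComplexConjugate

section Torus

variable {L : ℕ} [NeZero L]

/-! ### Saturation of the penalised sector energy -/

/-- **The penalised sector energy is nonpositive, for every coupling.** For all real `t, U, λ, ε`,
every form factor `g` and `n ≤ (L/2 - 1)·L`:
`minEnergyOn (hubbardTorus 2 L t U + λ W_ε) (szSector (2n) 0) ≤ 0`, `W_ε` the Kac-window pair penalty
of route `KacWindowPenalty` — tested on a unit vector supported on a pair-free configuration
`A↑ ∪ B↓` of the sector, on which `W_ε` vanishes and the Hubbard energy is `0`.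
Tasaki (2020) §2.1; Lieb, PRL 62 (1989) 1201. [folklore] -/
theorem penalised_minEnergyOn_le_zero (t U lam ε : ℝ) (g : Site 2 → ℝ) {n : ℕ}
    (hn : n ≤ (L / 2 - 1) * L) :
    (hubbardTorus 2 L t U + (lam : ℂ) • (∑ m : Fin 2 → ZMod L,
        if (2 * Real.pi / (L : ℝ)) ^ 2 * (∑ i : Fin 2, (((m i).valMinAbs : ℤ) : ℝ) ^ 2) ≤ ε ^ 2 then
          ((L : ℂ) ^ 2)⁻¹ • (Matrix.conjTranspose (pairFieldAt g L m) * pairFieldAt g L m)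
        else 0)).minEnergyOn (szSector (Λ := FermionTorus 2 L) (2 * n) 0) ≤ 0 := by
  obtain ⟨A, B, hA, hB, hAB, hsep⟩ := exists_pairFree_sets (L := L) hn
  obtain ⟨ψ, hψ, hψ1⟩ := exists_unit_supported_single (pairSet A B)
  have hK : ψ ∈ szSector (Λ := FermionTorus 2 L) (2 * n) 0 :=
    mem_szSector_of_supported hψ (by rw [upPart_pairSet, hA]) (by rw [downPart_pairSet, hB])
  refine (minEnergyOn_le_re_rayleigh _ _ hK hψ1).trans (le_of_eq ?_)
  rw [add_mulVec, dotProduct_add, Matrix.smul_mulVec, dotProduct_smul,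
    kacWindow_mulVec_eq_zero_of_supported g ε hsep hψ, dotProduct_zero, smul_zero, add_zero,
    star_dotProduct_hubbardTorus_mulVec_eq_zero_of_supported t U hAB hψ, Complex.zero_re]

/-- **The local pair repulsion saturates too.** The LOCAL singlet-bond repulsion `Σ_x P_xᴴ P_x`
(`P_x = localPair g L x`; the full-window form of `W_ε` by `stub_fullWindow`, and the base clause
`BaseGapLocal` of line parabolic-descent) vanishes on pair-free configurations as well, so
`minEnergyOn (hubbardTorus 2 L t U + λ Σ_x P_xᴴ P_x) (szSector (2n) 0) ≤ 0` for ALL real `t, U, λ`,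
every `g` and `n ≤ (L/2 - 1)·L`. Tasaki (2020) §2.1. [folklore] -/
theorem localRepulsion_minEnergyOn_le_zero (t U lam : ℝ) (g : Site 2 → ℝ) {n : ℕ}
    (hn : n ≤ (L / 2 - 1) * L) :
    (hubbardTorus 2 L t U + (lam : ℂ) •
        ∑ x : Fin 2 → ZMod L, (localPair g L x)ᴴ * localPair g L x).minEnergyOn
      (szSector (Λ := FermionTorus 2 L) (2 * n) 0) ≤ 0 := by
  obtain ⟨A, B, hA, hB, hAB, hsep⟩ := exists_pairFree_sets (L := L) hn
  obtain ⟨ψ, hψ, hψ1⟩ := exists_unit_supported_single (pairSet A B)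
  have hK : ψ ∈ szSector (Λ := FermionTorus 2 L) (2 * n) 0 :=
    mem_szSector_of_supported hψ (by rw [upPart_pairSet, hA]) (by rw [downPart_pairSet, hB])
  have hloc : (∑ x : Fin 2 → ZMod L, (localPair g L x)ᴴ * localPair g L x) *ᵥ ψ = 0 := by
    rw [Matrix.sum_mulVec]
    refine Finset.sum_eq_zero fun x _ => ?_
    rw [← mulVec_mulVec, localPair_mulVec_eq_zero_of_supported g hsep hψ x, mulVec_zero]
  refine (minEnergyOn_le_re_rayleigh _ _ hK hψ1).trans (le_of_eq ?_)
  rw [add_mulVec, dotProduct_add, Matrix.smul_mulVec, dotProduct_smul, hloc, dotProduct_zero, smul_zero,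
    add_zero, star_dotProduct_hubbardTorus_mulVec_eq_zero_of_supported t U hAB hψ, Complex.zero_re]

/-- **The sector ground energy of the repulsive Hubbard torus is at least `-4` per electron**:
for `U ≥ 0`, `L ≥ 3` and `n ≤ L²`, `-8n ≤ minEnergyOn (hubbardTorus 2 L 1 U) (szSector (2n) 0)`
(drop the nonnegative interaction; the free kinetic energy in chemical-potential form at `μ = -4`,
`re_expect_hubbardTorus_zero_ge`, with the band bound `ε_L(k) ≥ -4`). Tasaki (2020) §2.1. [folklore] -/
theorem neg_eight_mul_le_minEnergyOn_hubbardTorus (hL : 3 ≤ L) {U : ℝ} (hU : 0 ≤ U) {n : ℕ}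
    (hn : n ≤ L ^ 2) :
    -(8 * (n : ℝ)) ≤ (hubbardTorus 2 L 1 U).minEnergyOn (szSector (Λ := FermionTorus 2 L) (2 * n) 0) := by
  obtain ⟨ψ₀, hψ₀1, hψ₀gs⟩ :=
    Summit.HubbardSuperconductivity.NoGo.exists_unit_groundStateInSector_hubbardTorus L 1 U hn
  refine LowEnergyRigidity.Telescope.le_minEnergyOn_of_forall_unit _ _ ⟨ψ₀, hψ₀gs.1, hψ₀1⟩
    fun ψ hψK hψ1 => ?_
  have hψN : IsNParticle (2 * n) ψ := ((mem_szSector_iff _ _ _).1 hψK).1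
  have hfree := Summit.HubbardSuperconductivity.TwTipContinuation.IsogapTransport.re_expect_hubbardTorus_zero_ge
    hL (-4) hψN hψ1
  have hsum : ∑ k : TorusSite 2 L, 2 * min (torusBand L k - (-4)) 0 = 0 := by
    refine Finset.sum_eq_zero fun k _ => ?_
    rw [min_eq_right (by linarith [neg_four_le_torusBand L k]), mul_zero]
  rw [hsum, zero_add] at hfree
  have hint := (re_expect_interaction_torus_mem_Icc ψ).1
  have hsplit : (star ψ ⬝ᵥ (hubbardTorus 2 L 1 U *ᵥ ψ)).re =
      (star ψ ⬝ᵥ (hubbardTorus 2 L 1 0 *ᵥ ψ)).re +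
        U * (star ψ ⬝ᵥ ((∑ x : FermionTorus 2 L, numberOp x 0 * numberOp x 1 :
          Matrix (Finset (Orb (FermionTorus 2 L))) _ ℂ) *ᵥ ψ)).re := by
    rw [hubbardTorus_eq_zero_add_smul_interaction U, add_mulVec, Matrix.smul_mulVec, dotProduct_add,
      dotProduct_smul, smul_eq_mul, Complex.add_re, Complex.re_ofReal_mul]
  rw [hsplit]
  have h0 : -(8 * (n : ℝ)) ≤ (star ψ ⬝ᵥ (hubbardTorus 2 L 1 0 *ᵥ ψ)).re := by
    have : (-4 : ℝ) * ((2 * n : ℕ) : ℝ) = -(8 * (n : ℝ)) := by push_cast; ring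
    rw [← this]
    exact hfree
  nlinarith

/-- **Penalty saturation** (target (T2) of the crux notes). For `U ≥ 0`, `L ≥ 3`, `n ≤ (L/2 - 1)·L`,
ALL real `t = 1`-torus couplings `λ` and window radii `ε`, and every form factor `g`:
`minEnergyOn (H + λW_ε) K − minEnergyOn H K ≤ 8n` with `H = hubbardTorus 2 L 1 U`,
`K = szSector (2n) 0`: the Kac-window excess is at most `4` per electron, however strong the penalty
(the sector contains pair-free configurations of zero energy, and `H ≥ -4` per electron).
Tasaki (2020) §2.1; Lieb, PRL 62 (1989) 1201. [folklore] -/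
theorem windowGap_saturation (hL : 3 ≤ L) {U : ℝ} (hU : 0 ≤ U) (lam ε : ℝ) (g : Site 2 → ℝ) {n : ℕ}
    (hn : n ≤ (L / 2 - 1) * L) :
    (hubbardTorus 2 L 1 U + (lam : ℂ) • (∑ m : Fin 2 → ZMod L,
        if (2 * Real.pi / (L : ℝ)) ^ 2 * (∑ i : Fin 2, (((m i).valMinAbs : ℤ) : ℝ) ^ 2) ≤ ε ^ 2 then
          ((L : ℂ) ^ 2)⁻¹ • (Matrix.conjTranspose (pairFieldAt g L m) * pairFieldAt g L m)
        else 0)).minEnergyOn (szSector (Λ := FermionTorus 2 L) (2 * n) 0) -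
      (hubbardTorus 2 L 1 U).minEnergyOn (szSector (Λ := FermionTorus 2 L) (2 * n) 0) ≤ 8 * n := by
  have hnL : n ≤ L ^ 2 := hn.trans (by nlinarith [Nat.sub_le (L / 2) 1, Nat.div_le_self L 2])
  have h1 := penalised_minEnergyOn_le_zero (L := L) 1 U lam ε g hn
  have h2 := neg_eight_mul_le_minEnergyOn_hubbardTorus hL hU hnL
  linarith

/-- **Saturation of the local base** (line parabolic-descent, clause (i) of `stub_localCertificate`):
for `U ≥ 0`, `L ≥ 3`, `n ≤ (L/2 - 1)·L`, ALL real `λ` and every `g`,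
`minEnergyOn (H + λ Σ_x P_xᴴP_x) K − minEnergyOn H K ≤ 8n` (`H = hubbardTorus 2 L 1 U`,
`K = szSector (2n) 0`); so a local base `λ⋆A⋆L² ≤ …` forces `λ⋆A⋆ ≤ 4(1-δ)` at the summit filling,
exactly as for the window. [folklore] -/
theorem localBase_saturation (hL : 3 ≤ L) {U : ℝ} (hU : 0 ≤ U) (lam : ℝ) (g : Site 2 → ℝ) {n : ℕ}
    (hn : n ≤ (L / 2 - 1) * L) :
    (hubbardTorus 2 L 1 U + (lam : ℂ) •
        ∑ x : Fin 2 → ZMod L, (localPair g L x)ᴴ * localPair g L x).minEnergyOn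
        (szSector (Λ := FermionTorus 2 L) (2 * n) 0) -
      (hubbardTorus 2 L 1 U).minEnergyOn (szSector (Λ := FermionTorus 2 L) (2 * n) 0) ≤ 8 * n := by
  have hnL : n ≤ L ^ 2 := hn.trans (by nlinarith [Nat.sub_le (L / 2) 1, Nat.div_le_self L 2])
  have h1 := localRepulsion_minEnergyOn_le_zero (L := L) 1 U lam g hn
  have h2 := neg_eight_mul_le_minEnergyOn_hubbardTorus hL hU hnL
  linarith

omit [NeZero L] in
/-- The summit's pair number fits into the lower band: for `0 < δ`, even `L ≥ 2/δ`,
`⌊(1-δ)L²/2⌋ ≤ (L/2 - 1)·L` (indeed `(1-δ)L²/2 ≤ L²/2 - L` iff `δL ≥ 2`). [folklore] -/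
theorem floor_pairNumber_le_rows {δ : ℝ} (hδ : 0 < δ) (hLδ : 2 / δ ≤ (L : ℝ)) (hE : Even L) :
    ⌊(1 - δ) * (L : ℝ) ^ 2 / 2⌋₊ ≤ (L / 2 - 1) * L := by
  obtain ⟨m, rfl⟩ := hE
  have hm : (m + m) / 2 - 1 = m - 1 := by omega
  rw [hm]
  refine Nat.floor_le_of_le ?_
  have hδL : 2 ≤ δ * ((m + m : ℕ) : ℝ) := by
    rwa [div_le_iff₀ hδ, mul_comm] at hLδ
  rcases Nat.eq_zero_or_pos m with rfl | hmpos
  · simp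
  have hm1 : ((m - 1 : ℕ) : ℝ) = (m : ℝ) - 1 := by
    rw [Nat.cast_sub (by omega : 1 ≤ m), Nat.cast_one]
  push_cast at hδL ⊢
  rw [hm1]
  nlinarith

/-- **Penalty saturation at the summit's filling.** For `U ≥ 0`, `0 < δ ≤ 1`, even `L ≥ max 3 (2/δ)`,
ALL real `λ`, `ε` and every form factor `g`: with `K_L = szSector (2⌊(1-δ)L²/2⌋) 0`,
`minEnergyOn (hubbardTorus 2 L 1 U + λW_ε) K_L − minEnergyOn (hubbardTorus 2 L 1 U) K_L ≤ 4(1-δ)L²`.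
[folklore] -/
theorem windowGap_saturation_doping (hL : 3 ≤ L) {U δ : ℝ} (hU : 0 ≤ U) (hδ : 0 < δ) (hδ1 : δ ≤ 1)
    (hLδ : 2 / δ ≤ (L : ℝ)) (hE : Even L) (lam ε : ℝ) (g : Site 2 → ℝ) :
    (hubbardTorus 2 L 1 U + (lam : ℂ) • (∑ m : Fin 2 → ZMod L,
        if (2 * Real.pi / (L : ℝ)) ^ 2 * (∑ i : Fin 2, (((m i).valMinAbs : ℤ) : ℝ) ^ 2) ≤ ε ^ 2 then
          ((L : ℂ) ^ 2)⁻¹ • (Matrix.conjTranspose (pairFieldAt g L m) * pairFieldAt g L m)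
        else 0)).minEnergyOn (szSector (Λ := FermionTorus 2 L) (2 * ⌊(1 - δ) * (L : ℝ) ^ 2 / 2⌋₊) 0) -
      (hubbardTorus 2 L 1 U).minEnergyOn
        (szSector (Λ := FermionTorus 2 L) (2 * ⌊(1 - δ) * (L : ℝ) ^ 2 / 2⌋₊) 0) ≤
      4 * (1 - δ) * (L : ℝ) ^ 2 := by
  have h := windowGap_saturation hL hU lam ε g (floor_pairNumber_le_rows hδ hLδ hE)
  refine h.trans ?_
  have hfl : (⌊(1 - δ) * (L : ℝ) ^ 2 / 2⌋₊ : ℝ) ≤ (1 - δ) * (L : ℝ) ^ 2 / 2 :=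
    Nat.floor_le (by have : (0:ℝ) ≤ 1 - δ := by linarith
                     positivity)
  linarith

/-- **Consequence for witnesses of the crux body: the coupling–constants product is bounded.**
If at `(U, δ)` with `U ≥ 0`, `δ ∈ (0,1)` the crux inequality
`λ(Cε + a)L² ≤ minEnergyOn (H_L + λW_ε) K_L − minEnergyOn H_L K_L` holds for all even `L ≥ L₀`
(`λ, C, ε, a` arbitrary reals), then `λ(Cε + a) ≤ 4(1 - δ)`. Together with the landed
`windowGapAt_consts_le` (`Cε + a ≤ 32`) and `windowGap_small_lam` (WLOG `λ` small): any witness of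
`KacWindowPenalty.WindowGap` has `λ·a < 4` — a strong penalty buys nothing. [folklore] -/
theorem windowGap_coupling_mul_consts_le {U δ C ε lam a : ℝ} (hU : 0 ≤ U)
    (hδ : δ ∈ Set.Ioo (0 : ℝ) 1) {L₀ : ℕ}
    (h : ∀ (L : ℕ) [NeZero L], L₀ ≤ L → Even L →
      lam * (C * ε + a) * (L : ℝ) ^ 2 ≤
        (hubbardTorus 2 L 1 U + (lam : ℂ) • (∑ m : Fin 2 → ZMod L,
            if (2 * Real.pi / (L : ℝ)) ^ 2 * (∑ i : Fin 2, (((m i).valMinAbs : ℤ) : ℝ) ^ 2) ≤ ε ^ 2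
            then ((L : ℂ) ^ 2)⁻¹ • (Matrix.conjTranspose (pairFieldAt dWaveFormFactor L m) *
              pairFieldAt dWaveFormFactor L m)
            else 0)).minEnergyOn (szSector (2 * ⌊(1 - δ) * (L : ℝ) ^ 2 / 2⌋₊) 0) -
          (hubbardTorus 2 L 1 U).minEnergyOn (szSector (2 * ⌊(1 - δ) * (L : ℝ) ^ 2 / 2⌋₊) 0)) :
    lam * (C * ε + a) ≤ 4 * (1 - δ) := by
  -- an even side beyond every threshold
  set M : ℕ := max L₀ (max 3 ⌈2 / δ⌉₊) with hM
  haveI : NeZero (2 * M) := ⟨by omega⟩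
  have hL₀ : L₀ ≤ 2 * M := (le_max_left _ _).trans (Nat.le_mul_of_pos_left M two_pos)
  have h3 : 3 ≤ 2 * M := ((le_max_left 3 _).trans (le_max_right L₀ _)).trans
    (Nat.le_mul_of_pos_left M two_pos)
  have hceil : (⌈2 / δ⌉₊ : ℝ) ≤ ((2 * M : ℕ) : ℝ) := by
    have : ⌈2 / δ⌉₊ ≤ 2 * M := ((le_max_right 3 _).trans (le_max_right L₀ _)).trans
      (Nat.le_mul_of_pos_left M two_pos)
    exact_mod_cast this
  have hLδ : 2 / δ ≤ ((2 * M : ℕ) : ℝ) := (Nat.le_ceil _).trans hceil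
  have hE : Even (2 * M) := even_two_mul M
  have hgap := h (2 * M) hL₀ hE
  have hsat := windowGap_saturation_doping (L := 2 * M) h3 hU hδ.1 hδ.2.le hLδ hE lam ε dWaveFormFactor
  have hL2 : (0 : ℝ) < ((2 * M : ℕ) : ℝ) ^ 2 := by positivity
  have := hgap.trans hsat
  rw [show 4 * (1 - δ) * ((2 * M : ℕ) : ℝ) ^ 2 = (4 * (1 - δ)) * ((2 * M : ℕ) : ℝ) ^ 2 by ring] at this
  exact le_of_mul_le_mul_right this hL2

end Torus

end Summit.HubbardSuperconductivity.HubbardSuperconductivity.Theorems.WindowGap.Negative
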